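import Literature.MathematicalPhysics.QuantumFieldTheory.Balaban1983to89.B4Ineq120RegularRegion

/-!
# `Balaban1983to89.B4Eq54RegularRegion` — T. Bałaban, *Regularity and decay of lattice Green's functions*, Commun.
# Math. Phys. **89** (1983) 571–597 [Balaban1983RegularityDecay] (= B4), §5 pp. 593–594: the kernel bounds (5.4), (5.5)
# and the conditions (5.6), (5.9) of the Sect. 5 Theorem PROVED AT A REGULAR `A ≠ 0` (hypothesis-free in the analytic
# inputs) on every finite union of `L`-blocks / every nested pair of such regions

statement-level skeleton of published theorems with citation tags; proofs where landed; nothing here is a claim about the Yang–Mills mass gap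

PDF held: `paper:balaban1983-cmp89-regularity-decay` (journal page = PDF page + 570); pp. 593–594 [PDF 23–24] read on the
×2 renders `…/b2b-balaban-ref1/pages/1983-cmp89-regularity-decay/…-p023-x2.png`, `…-p024-x2.png`.

CITATION HEADER (lean-in-tree rule).  Cell `lit-balaban` (HOME `run/shared/lean/pub/lit-balaban/`), Phase-2 proof seat
**p17** gen 3 (unit `lit-balaban-p17-g3`), file 7 — SKELETON rows **B4.Eq5.4** ((5.4), (5.5); owner r01, referee ref-4;
r01's cell: «at A ≠ 0: proved p245369 modulo Cor 2.3 / Thm (1.11)–(1.12) at A ≠ 0, as hypotheses» — `B4Prop23Sect5Route.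
abs_kOp_apply_le_exp`, `abs_deltaK_sub_apply_le_exp`, `hyp56_kOp`, `hyp59_deltaK_sub`) and **B4.Thm@594** (the conditions
(5.6), (5.9) `B4Sect5Torus.Hyp56` / `Hyp59`); companion of this seat's `B4Ineq53RegularRegion` ((5.1)–(5.3), p251686),
`B4Prop23RegularRegion` ((1.16)–(1.18), p252479), `B4Ineq120RegularAmbient`/`B4Ineq120RegularRegion` ((1.19)–(1.20),
p253259/p253846), whose inputs — gen 2's `B4Cor23Rep36Bridge.hG_regularPair` (Corollary 2.3 (2.30) at a regular `A ≠ 0`,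
b04 `B4Cor23Region`) and `hGd_regular` (the `δG` clause, b04 `B4Cor23RegionDelta.dcor23_main_region`) — discharge r01's
hypotheses.  Nothing is restated; the theorems below are the printed displays (5.4), (5.5) as KERNEL bounds on the
concrete two-level carriers, which the leaf files only used internally.

WHAT IS PRINTED (pp. 593–594 [PDF 23–24], verbatim).  *"Finally Corollary 2.3 implies that the considered operator is
short-ranged in the sense that for some δ₀ > 0 |(Δ^{(k)}(Ω,A) + aL^{−2}P(A))(x,x′)| ≤ c₀e^{−δ₀|x−x′|}. (5.4)  These three
properties of the operator imply the inequalities (1.15), (1.16), (1.18), as we will see from the theorem formulated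
below.  To get (1.20), let us notice that a change of the domain Ω implies a change of the operator which can be
estimated in the following way |(Δ^{(k)}(Ω,A) − Δ^{(k)}(Ω₀,A))(x,x′)| ≤ c₀e^{−δ₀(|x−x′| + dist(x,Ω^{(k)c}) + dist(x′,Ω^{(k)c}))},
Ω ⊂ Ω₀. (5.5)"*; p. 594, the Theorem: *"let A be a symmetric operator on L²(Ω) satisfying the conditions
A ≥ γ₀I, γ₀ > 0, |A(x,x′)| ≤ c₀e^{−δ₀|x−x′|}, x, x′ ∈ Ω. (5.6) … If B is an operator satisfying (5.6) and
|B(x,x′)| ≤ c₀e^{−δ₀(|x−x′| + dist(x,Ω^c) + dist(x′,Ω^c))}, x, x′ ∈ Ω, (5.9) then …"*.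

DICTIONARY (as in the companion files).  `Ω^{(k)}` = a finite union of `L`-blocks of unit sites INDEXED BY ITS
`L`-BLOCK LABELS `Zc` (`fineDom L Zc`), fine region `fineDom n (fineDom L Zc)` (mesh `η = 1/n`), `Y = Ω^{(k)} × {colours}`;
`Δ^{(k)}(Ω,A) = B4GaussRep36.deltaK (hamR F e m² Ω^{(k)} A n) a_k (QkR …)` ((1.14), r01's dictionary on b04's
regular-region operator, gen 2 `B4Cor23Rep36Bridge`), `aL^{−2}P(A) = (a′L^{−2})•pOp L^{d+1} (nextAvg …)` ((5.1)–(5.2),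
`B4NextAvg52`); for `Ω ⊂ Ω₀` (labels `Zc ⊆ Z₀c`) the operator of `Ω₀` SEEN FROM `Ω^{(k)}` has form matrix `H₀ = ham0`
(`B4Ineq120RegularAmbient`; `deltaK_incl`: its `Δ^{(k)}` IS `Δ^{(k)}(Ω₀,A)` at the included points); `|x − x′| = |·|_∞`
on `Y` (`rhoY`), `dist(x, Ω^{(k)c})` = `omegaY` (`|·|_∞`-distance to `Ω₀^{(k)}∖Ω^{(k)}`, b04's reading inside the ambient
region).  Regular field: (1.7) `|A_ν(x+e_μ) − A_ν(x)| ≤ c·e^{β−1}/n` on the fine region (`h17`) and `e` small (`hsmall`;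
for (5.6) also `hsmallU`, `hX` of `B4Ineq53RegularRegion`, the smallness behind (5.3)).

WHAT IS KERNEL-CHECKED (zero `sorry`, standard axioms, no `def`, no `Prop`-valued definition, imports
`B4Ineq120RegularRegion` only).
* **`ineq54_regular`** — (5.4) at a regular `A ≠ 0`: `|(Δ^{(k)}(Ω,A) + a′L^{−2}P(A))(y,y′)| ≤ c54·e^{−δ₀(d,a_k)|y−y′|_∞}` for
  ALL `y, y′ ∈ Y`, `c54 = (a_k²c₀(a_k) + a′L^{−2} + a_k)e^{δ₀(d,a_k)L}` (`B4Prop23RegularRegion.c54`), from Corollary 2.3 at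
  `A ≠ 0` (`hG_regularPair`) by r01's `abs_kOp_apply_le_exp` — the print's *"Corollary 2.3 implies … (5.4)"*.
* **`ineq55_regular`** (form-matrix form, `H₀ = ham0`) and **`ineq55_regular_incl`** (LITERAL form: `Δ^{(k)}(Ω₀,A)` is
  `Ω₀`'s own operator evaluated at the included points `ιy, ιy′`) — (5.5) at a regular `A ≠ 0`:
  `|(Δ^{(k)}(Ω,A) − Δ^{(k)}(Ω₀,A))(y,y′)| ≤ a_k²c₁(d,a_k)e^{3(δ₀/2)(L+1)}·e^{−(δ₀/2)(|y−y′|_∞ + dist(y,Ω^{(k)c}) + dist(y′,Ω^{(k)c}))}`,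
  from the `δG` clause of Corollary 2.3 at `A ≠ 0` (`hGd_regular`) by r01's `abs_deltaK_sub_apply_le_exp`.
* **`hyp56_regular`** — condition (5.6) `B4Sect5Torus.Hyp56 |·|_∞ (Δ^{(k)}(Ω,A) + a′L^{−2}P(A)) γ₀″ c54 δ₀(d,a_k)` with
  `γ₀″ = gamLow` ((5.3), `form115_lower_regular`); **`hyp56_ambient_regular`** — the same for the operator of `Ω₀` seen
  from `Ω^{(k)}` (constants `c₁(d,a_k)`, `δ₀/2`; lower bound `form115_lower_ambient`); **`hyp59_regular`** — condition (5.9)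
  `Hyp59 |·|_∞ dist(·,Ω^{(k)c}) (Δ^{(k)}(Ω₀,A) − Δ^{(k)}(Ω,A)) (a_k²c₁e^{3(δ₀/2)(L+1)}) (δ₀/2)`.
HONEST SCOPE.  Constants depend on `(d, N, L, a_k, a′, …)` as in GAPS G-B4-p17-01; the rate of (5.5)/(5.9) is b04's
`δ₀(d,a_k)/2` (the `δG` clause, D-b04g14-3); `dist(x, Ω^{(k)c})` read inside `Ω₀^{(k)}` (literal `Z^d∖Ω^{(k)}` is
SMALLER, cf. `B4Prop23RegularFamilyLit`); (5.4)/(5.5) hold for all `y, y′` (no restriction).  Unit `lit-balaban-p17-g3`.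
-/

namespace Literature.MathematicalPhysics.QuantumFieldTheory.Balaban1983to89.B4Eq54RegularRegion

open Finset Matrix
open Literature.MathematicalPhysics.QuantumFieldTheory.Balaban1983to89
open Literature.MathematicalPhysics.QuantumFieldTheory.Balaban1983to89.B4GaugeCovariance (OrthFlow)
open Literature.MathematicalPhysics.QuantumFieldTheory.Balaban1983to89.B4Lower18Regular (e1)
open Literature.MathematicalPhysics.QuantumFieldTheory.Balaban1983to89.B4Lower18 (fineDom)
open Literature.MathematicalPhysics.QuantumFieldTheory.Balaban1983to89.B4TwoRegion120 (fineDom_mono)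
open Literature.MathematicalPhysics.QuantumFieldTheory.Balaban1983to89.B4Cor23Region (c0R delta0R c0R_pos delta0R_pos)
open Literature.MathematicalPhysics.QuantumFieldTheory.Balaban1983to89.B4Cor23RegionDelta (c1R two_c0R_le_c1R)
open Literature.MathematicalPhysics.QuantumFieldTheory.Balaban1983to89.B4Sect5Torus (Hyp56 Hyp59)
open Literature.MathematicalPhysics.QuantumFieldTheory.Balaban1983to89.B4GaussRep36 (pOp)
open Literature.MathematicalPhysics.QuantumFieldTheory.Balaban1983to89.B4Prop23BlockAvg (abs_pOp_le_one)
open Literature.MathematicalPhysics.QuantumFieldTheory.Balaban1983to89.B4Prop23Sect5Route (abs_kOp_apply_le_exp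
  abs_deltaK_sub_apply_le_exp hyp56_kOp hyp59_deltaK_sub)
open Literature.MathematicalPhysics.QuantumFieldTheory.Balaban1983to89.B4Cor23Rep36Bridge (hamR QkR hamR_isSymm bl2n_sq
  hG_regularPair)
open Literature.MathematicalPhysics.QuantumFieldTheory.Balaban1983to89.B4NextAvg52 (nextAvg rowOrtho_nextAvg)
open Literature.MathematicalPhysics.QuantumFieldTheory.Balaban1983to89.B4Ineq53RegularRegion (gam0 gamLow
  form115_lower_regular)
open Literature.MathematicalPhysics.QuantumFieldTheory.Balaban1983to89.B4Prop23RegularRegion (rhoY rhoY_isPseudoDist suppK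
  QkR_row_support QkR_row_sq rhoY_le_sdistR rhoY_le_of_pOp_ne_zero c54)
open Literature.MathematicalPhysics.QuantumFieldTheory.Balaban1983to89.B4Ineq120RegularAmbient (inclι fine_sub ham0
  ham0_isSymm deltaK_incl form115_lower_ambient)
open Literature.MathematicalPhysics.QuantumFieldTheory.Balaban1983to89.B4Ineq120RegularRegion (hG0_regular hGd_regular
  omegaY omegaY_le_sdc)

noncomputable section

variable {d : ℕ} {ι : Type} [Fintype ι] [DecidableEq ι]

/-! ## §1. (5.4) at a regular `A ≠ 0` -/

section OneRegion

variable (F : OrthFlow ι) {ℓ : ℝ} (hℓ : 0 ≤ ℓ)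
  (hLip : ∀ t (v : ι → ℝ), ((F.U t - 1) *ᵥ v) ⬝ᵥ ((F.U t - 1) *ᵥ v) ≤ (ℓ * t) ^ 2 * (v ⬝ᵥ v))
  {e : ℝ} (he : 0 < e) {n L : ℕ} (hn : 1 ≤ n) (hL : 1 ≤ L) {a : ℝ} (ha : 0 < a) {a' : ℝ} (ha' : 0 < a')
  {m2 m2max : ℝ} (hm : 0 ≤ m2) (hmm : m2 ≤ m2max) (Zc : Finset (Fin (d + 1) → ℤ))
  {Ac : (Fin (d + 1) → ℤ) → Fin (d + 1) → ℝ} {c β : ℝ} (hc : 0 ≤ c)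
  (h17 : ∀ x ∈ fineDom n (fineDom L Zc), ∀ μ ν : Fin (d + 1), |Ac (x + e1 μ) ν - Ac x ν| ≤ c * e ^ (β - 1) / n)
  (hsmall : ℓ ^ 2 * ((d + 1) * c * e ^ β) ^ 2 * (d + 1) * (1 + a * (d + 1)) ≤ min 2 a / 4)
  (hsmallU : ℓ ^ 2 * ((d + 1) * ((L : ℝ) ^ 2 * c) * e ^ β) ^ 2 * (d + 1)
      * (1 + (a' / gam0 d a m2max) * (d + 1)) ≤ min 2 (a' / gam0 d a m2max) / 4)
  (hX : gam0 d a m2 * (6 * (d + 1) * (a / (min 2 a / 4 + m2)) ^ 2 * (ℓ * ((3 * d + 4) * c * e ^ β)) ^ 2)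
      ≤ gamLow d L a a' m2max)

include hℓ hLip he ha ha' hm hc h17 hsmall in
/-- **(5.4) AT A REGULAR `A ≠ 0`** (p. 593: *"Finally Corollary 2.3 implies that the considered operator is short-ranged
in the sense that for some δ₀ > 0 |(Δ^{(k)}(Ω,A) + aL^{−2}P(A))(x,x′)| ≤ c₀e^{−δ₀|x−x′|}. (5.4)"*): for every mesh
`n ≥ 1`, `L ≥ 1`, every finite union `Ω^{(k)}` of `L`-blocks of unit sites, every `m² ≥ 0`, every vector field with (1.7)
on the fine region and `e` small, and ALL `y, y′ ∈ Ω^{(k)} × {colours}`: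
`|(Δ^{(k)}(Ω,A) + a′L^{−2}P(A))(y,y′)| ≤ c54·e^{−δ₀(d,a_k)|y−y′|_∞}`, `c54 = (a_k²c₀(a_k) + a′L^{−2} + a_k)e^{δ₀(d,a_k)L}` —
Corollary 2.3 (2.30) at `A ≠ 0` (`hG_regularPair`), the supports `B^k(y)` and unit norms of the rows `q_k(y)`,
`|P(A)| ≤ 1` and r01's `abs_kOp_apply_le_exp`. [cite: Balaban1983RegularityDecay, (5.4) p.593, Cor. 2.3 (2.30) p.580, (5.1) p.593] -/
theorem ineq54_regular (y y' : ↥(fineDom L Zc) × ι) :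
    |(B4GaussRep36.deltaK (hamR F e m2 (fineDom L Zc) Ac n) a (QkR F e hn (fineDom L Zc) Ac)
        + (a' * ((L : ℝ) ^ 2)⁻¹) • pOp (((L ^ (d + 1) : ℕ) : ℝ)) (nextAvg F (e / n) hL Zc n Ac)) y y'|
      ≤ c54 d L a a' * Real.exp (-(delta0R d a * rhoY L Zc y y')) := by
  have hw : (((L ^ (d + 1) : ℕ) : ℝ)) ≠ 0 := by
    have : 0 < L ^ (d + 1) := pow_pos hL _
    exact_mod_cast this.ne'
  have hρ0 : ∀ p : ↥(fineDom L Zc) × ι, rhoY L Zc p p ≤ L := fun p => by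
    rw [(rhoY_isPseudoDist (ι := ι) Zc).zero]; exact_mod_cast (Nat.zero_le L)
  exact abs_kOp_apply_le_exp (suppK Zc hn) (QkR_row_support Zc hn F e Ac) (QkR_row_sq Zc hn F e Ac) bl2n_sq
    zero_le_one (c0R_pos ha).le zero_le_one ha.le (by positivity)
    (hG_regularPair F hℓ hLip he hn ha hm (fineDom L Zc) hc h17 hsmall) (delta0R_pos d ha).le
    (rhoY_le_sdistR hL Zc hn) (rhoY_le_of_pOp_ne_zero hL Zc F e Ac) hρ0
    (fun p q => abs_pOp_le_one (rowOrtho_nextAvg F (e / n) hL Zc n Ac) hw p q) y y'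

include hℓ hLip he ha ha' hm hmm hc h17 hsmall hsmallU hX in
/-- **CONDITION (5.6) OF THE SECT. 5 THEOREM FOR `Δ^{(k)}(Ω,A) + a′L^{−2}P(A)` AT A REGULAR `A ≠ 0`** (p. 594: *"let A be
a symmetric operator on L²(Ω) satisfying the conditions A ≥ γ₀I, γ₀ > 0, |A(x,x′)| ≤ c₀e^{−δ₀|x−x′|}, x, x′ ∈ Ω. (5.6)"*;
p. 593: *"These three properties of the operator imply the inequalities (1.15), (1.16), (1.18)"*): symmetry, the lower
bound (5.3) with `γ₀″ = gamLow` (`form115_lower_regular`, for `m² ≤ m²₊` and `e` small as there) and (5.4)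
(`ineq54_regular`), in the typing `B4Sect5Torus.Hyp56` with `|x−x′| = |·|_∞` on `Ω^{(k)} × {colours}`.
[cite: Balaban1983RegularityDecay, (5.6) p.594, (5.3)–(5.4) p.593] -/
theorem hyp56_regular :
    Hyp56 (rhoY L Zc) (B4GaussRep36.deltaK (hamR F e m2 (fineDom L Zc) Ac n) a (QkR F e hn (fineDom L Zc) Ac)
        + (a' * ((L : ℝ) ^ 2)⁻¹) • pOp (((L ^ (d + 1) : ℕ) : ℝ)) (nextAvg F (e / n) hL Zc n Ac))
      (gamLow d L a a' m2max) (c54 d L a a') (delta0R d a) :=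
  hyp56_kOp (hamR_isSymm F e m2 (fineDom L Zc) Ac)
    (form115_lower_regular F hℓ hLip he hn hL ha ha' hm hmm Zc hc h17 hsmall hsmallU hX)
    (ineq54_regular F hℓ hLip he hn hL ha ha' hm Zc hc h17 hsmall)

end OneRegion

/-! ## §2. (5.5) at a regular `A ≠ 0` (nested regions `Ω ⊂ Ω₀`) -/

section TwoRegions

variable {n L : ℕ} (hn : 1 ≤ n) (hL : 1 ≤ L) {Zc Z₀c : Finset (Fin (d + 1) → ℤ)} (hsub : Zc ⊆ Z₀c)
  (F : OrthFlow ι) {ℓ : ℝ} (hℓ : 0 ≤ ℓ)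
  (hLip : ∀ t (v : ι → ℝ), ((F.U t - 1) *ᵥ v) ⬝ᵥ ((F.U t - 1) *ᵥ v) ≤ (ℓ * t) ^ 2 * (v ⬝ᵥ v))
  {e : ℝ} (he : 0 < e) {a : ℝ} (ha : 0 < a) {a' : ℝ} (ha' : 0 < a') {m2 m2max : ℝ} (hm : 0 ≤ m2) (hmm : m2 ≤ m2max)
  {Ac : (Fin (d + 1) → ℤ) → Fin (d + 1) → ℝ} {c β : ℝ} (hc : 0 ≤ c)
  (h17 : ∀ x ∈ fineDom n (fineDom L Z₀c), ∀ μ ν : Fin (d + 1), |Ac (x + e1 μ) ν - Ac x ν| ≤ c * e ^ (β - 1) / n)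
  (hsmall : ℓ ^ 2 * ((d + 1) * c * e ^ β) ^ 2 * (d + 1) * (1 + a * (d + 1)) ≤ min 2 a / 4)
  (hsmallU : ℓ ^ 2 * ((d + 1) * ((L : ℝ) ^ 2 * c) * e ^ β) ^ 2 * (d + 1)
      * (1 + (a' / gam0 d a m2max) * (d + 1)) ≤ min 2 (a' / gam0 d a m2max) / 4)
  (hX : gam0 d a m2 * (6 * (d + 1) * (a / (min 2 a / 4 + m2)) ^ 2 * (ℓ * ((3 * d + 4) * c * e ^ β)) ^ 2)
      ≤ gamLow d L a a' m2max)

include hℓ hLip he ha hm hc h17 hsmall in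
/-- **(5.5) AT A REGULAR `A ≠ 0`, form-matrix form** (p. 594: *"a change of the domain Ω implies a change of the operator
which can be estimated in the following way |(Δ^{(k)}(Ω,A) − Δ^{(k)}(Ω₀,A))(x,x′)| ≤ c₀e^{−δ₀(|x−x′| + dist(x,Ω^{(k)c}) +
dist(x′,Ω^{(k)c}))}, Ω ⊂ Ω₀. (5.5)"*): for every NESTED pair of finite unions of `L`-blocks (labels `Zc ⊆ Z₀c`), every
`m² ≥ 0`, every vector field with (1.7) on the fine region of `Ω₀` and `e` small, and ALL `y, y′ ∈ Ω^{(k)} × {colours}`: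
the entries of `Δ^{(k)}(Ω,A) − Δ^{(k)}(Ω₀,A)|_{Ω^{(k)}}` (the latter with form matrix `H₀ = ham0`) are
`≤ a_k²c₁(d,a_k)e^{3(δ₀/2)(L+1)}·e^{−(δ₀(d,a_k)/2)(|y−y′|_∞ + ω(y) + ω(y′))}`, `ω = omegaY = dist_∞(·, Ω₀^{(k)}∖Ω^{(k)})` — the
`δG` clause of Corollary 2.3 at `A ≠ 0` (`hGd_regular`, b04 `dcor23_main_region`) and r01's `abs_deltaK_sub_apply_le_exp`.
[cite: Balaban1983RegularityDecay, (5.5) p.594, Cor. 2.3 p.581 (δG clause), (1.11) p.573] -/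
theorem ineq55_regular (y y' : ↥(fineDom L Zc) × ι) :
    |(B4GaussRep36.deltaK (hamR F e m2 (fineDom L Zc) Ac n) a (QkR F e hn (fineDom L Zc) Ac)
        - B4GaussRep36.deltaK (ham0 F e hn hL a m2 hsub Ac) a (QkR F e hn (fineDom L Zc) Ac)) y y'|
      ≤ a ^ 2 * (c1R d a * (1 * 1)) * Real.exp (3 * (delta0R d a / 2 * ((L : ℝ) + 1)))
        * Real.exp (-(delta0R d a / 2 * (rhoY L Zc y y' + omegaY L Zc Z₀c y + omegaY L Zc Z₀c y'))) := by
  have hC : 0 ≤ c1R d a := by linarith [two_c0R_le_c1R d ha, c0R_pos ha]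
  exact abs_deltaK_sub_apply_le_exp (suppK Zc hn) (QkR_row_support Zc hn F e Ac) (QkR_row_sq Zc hn F e Ac) bl2n_sq
    zero_le_one hC zero_le_one (hGd_regular hn hL hsub F hℓ hLip he ha hm hc h17 hsmall)
    (half_pos (delta0R_pos d ha)).le (fun p q => (rhoY_le_sdistR hL Zc hn p q).trans (by linarith))
    (fun p => (omegaY_le_sdc hn hL hsub p).trans (by linarith)) y y'

include hℓ hLip he ha hm hc h17 hsmall in
/-- **(5.5) AT A REGULAR `A ≠ 0`, LITERAL FORM**: with `Δ^{(k)}(Ω₀,A)` the operator (1.14) OF `Ω₀` ITSELF evaluated at the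
included points `ιy, ιy′ ∈ Ω₀^{(k)} × {colours}` (`deltaK_incl`), same bound as `ineq55_regular`.
[cite: Balaban1983RegularityDecay, (5.5) p.594, (1.14) p.573, Cor. 2.3 p.581 (δG clause)] -/
theorem ineq55_regular_incl (y y' : ↥(fineDom L Zc) × ι) :
    |B4GaussRep36.deltaK (hamR F e m2 (fineDom L Zc) Ac n) a (QkR F e hn (fineDom L Zc) Ac) y y'
        - B4GaussRep36.deltaK (hamR F e m2 (fineDom L Z₀c) Ac n) a (QkR F e hn (fineDom L Z₀c) Ac)
            (inclι (fineDom_mono hL hsub) y) (inclι (fineDom_mono hL hsub) y')|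
      ≤ a ^ 2 * (c1R d a * (1 * 1)) * Real.exp (3 * (delta0R d a / 2 * ((L : ℝ) + 1)))
        * Real.exp (-(delta0R d a / 2 * (rhoY L Zc y y' + omegaY L Zc Z₀c y + omegaY L Zc Z₀c y'))) := by
  rw [deltaK_incl hn hL hsub hℓ hLip he ha hm hc h17 hsmall, ← Matrix.sub_apply]
  exact ineq55_regular hn hL hsub F hℓ hLip he ha hm hc h17 hsmall y y'

include hℓ hLip he ha ha' hm hmm hc h17 hsmall hsmallU hX in
/-- **CONDITION (5.6) FOR THE OPERATOR OF `Ω₀` SEEN FROM `Ω^{(k)}`** (`Δ^{(k)}(Ω₀,A)|_{Ω^{(k)}} + a′L^{−2}P(A)`, form matrix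
`H₀ = ham0`; the `A + B` of the Theorem p. 594): symmetry (`ham0_isSymm`), the lower bound (5.3) transported from `Ω₀`
(`form115_lower_ambient` ∘ `form115_lower_regular` on `Ω₀`) and (5.4) from Corollary 2.3 on `Ω₀` for the extensions by
zero (`hG0_regular`), constants `γ₀″ = gamLow`, `c₀ = (a_k²c₁(d,a_k) + a′L^{−2} + a_k)e^{(δ₀/2)(L+1)}`, rate `δ₀(d,a_k)/2`.
[cite: Balaban1983RegularityDecay, (5.6) p.594, (5.3)–(5.4) p.593, Cor. 2.3 (2.30) p.580] -/
theorem hyp56_ambient_regular :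
    Hyp56 (rhoY L Zc) (B4GaussRep36.deltaK (ham0 F e hn hL a m2 hsub Ac) a (QkR F e hn (fineDom L Zc) Ac)
        + (a' * ((L : ℝ) ^ 2)⁻¹) • pOp (((L ^ (d + 1) : ℕ) : ℝ)) (nextAvg F (e / n) hL Zc n Ac))
      (gamLow d L a a' m2max)
      ((a ^ 2 * (c1R d a * (1 * 1)) + a' * ((L : ℝ) ^ 2)⁻¹ + a) * Real.exp (delta0R d a / 2 * ((L : ℝ) + 1)))
      (delta0R d a / 2) := by
  have hw : (((L ^ (d + 1) : ℕ) : ℝ)) ≠ 0 := by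
    have : 0 < L ^ (d + 1) := pow_pos hL _
    exact_mod_cast this.ne'
  have hC : 0 ≤ c1R d a := by linarith [two_c0R_le_c1R d ha, c0R_pos ha]
  have hL0 : (0 : ℝ) ≤ L := Nat.cast_nonneg L
  have hρ0 : ∀ p : ↥(fineDom L Zc) × ι, rhoY L Zc p p ≤ (L : ℝ) + 1 := fun p => by
    rw [(rhoY_isPseudoDist (ι := ι) Zc).zero]; linarith
  exact hyp56_kOp (ham0_isSymm F e hn hL a m2 hsub Ac)
    (form115_lower_ambient hn hL hsub hℓ hLip he ha hm hc h17 hsmall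
      (form115_lower_regular F hℓ hLip he hn hL ha ha' hm hmm Z₀c hc h17 hsmall hsmallU hX))
    (abs_kOp_apply_le_exp (suppK Zc hn) (QkR_row_support Zc hn F e Ac) (QkR_row_sq Zc hn F e Ac) bl2n_sq
      zero_le_one hC zero_le_one ha.le (by positivity) (hG0_regular hn hL hsub F hℓ hLip he ha hm hc h17 hsmall)
      (half_pos (delta0R_pos d ha)).le (fun p q => (rhoY_le_sdistR hL Zc hn p q).trans (by linarith))
      (fun p q h => (rhoY_le_of_pOp_ne_zero hL Zc F e Ac p q h).trans (by linarith)) hρ0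
      (fun p q => abs_pOp_le_one (rowOrtho_nextAvg F (e / n) hL Zc n Ac) hw p q))

include hℓ hLip he ha hm hc h17 hsmall in
/-- **CONDITION (5.9) OF THE SECT. 5 THEOREM AT A REGULAR `A ≠ 0`** (p. 594: *"If B is an operator satisfying (5.6) and
|B(x,x′)| ≤ c₀e^{−δ₀(|x−x′| + dist(x,Ω^c) + dist(x′,Ω^c))}, x, x′ ∈ Ω, (5.9)"*) for the perturbation
`B = Δ^{(k)}(Ω₀,A)|_{Ω^{(k)}} − Δ^{(k)}(Ω,A)` taking the operator of `Ω` to that of `Ω₀` (`P(A)` cancels), boundary weight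
`ω = dist_∞(·, Ω₀^{(k)}∖Ω^{(k)})`, constants `a_k²c₁(d,a_k)e^{3(δ₀/2)(L+1)}`, `δ₀(d,a_k)/2` — (5.5) (`ineq55_regular`) in the
typing `B4Sect5Torus.Hyp59` (r01's `hyp59_deltaK_sub`). [cite: Balaban1983RegularityDecay, (5.9) p.594, (5.5) p.594] -/
theorem hyp59_regular :
    Hyp59 (rhoY L Zc) (omegaY L Zc Z₀c)
      (B4GaussRep36.deltaK (ham0 F e hn hL a m2 hsub Ac) a (QkR F e hn (fineDom L Zc) Ac)
        - B4GaussRep36.deltaK (hamR F e m2 (fineDom L Zc) Ac n) a (QkR F e hn (fineDom L Zc) Ac))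
      (a ^ 2 * (c1R d a * (1 * 1)) * Real.exp (3 * (delta0R d a / 2 * ((L : ℝ) + 1)))) (delta0R d a / 2) :=
  hyp59_deltaK_sub (ineq55_regular hn hL hsub F hℓ hLip he ha hm hc h17 hsmall)

end TwoRegions

end

end Literature.MathematicalPhysics.QuantumFieldTheory.Balaban1983to89.B4Eq54RegularRegion
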